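import Literature.MathematicalPhysics.QuantumManyBody.PeriodicBoseGasScattering
import Literature.MathematicalPhysics.QuantumManyBody.PeriodicBoseGasBogoliubovSquare
import Mathlib.Analysis.SpecialFunctions.ImproperIntegrals
import HarnessLib

/-!
# Fournais 2020, (2.36)–(2.41): the momentum integrals of the Bogoliubov bound

Topic `Literature/MathematicalPhysics/QuantumManyBody` (provefact
`Literature.MathematicalPhysics.QuantumManyBody.BoseGas.Fournais2020_condensation`, layer `Fournais2020_lemma24`).
After the completion of the square (2.33)–(2.35) (`PeriodicBoseGasBogoliubovSquare.lean`), the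
proof of [Fournais2020, Lemma 2.4] integrates `-n(𝒜(p) - √(𝒜(p)² - Ŵ₁(p)²))` over the momentum,
with `𝒜(p) = (ℓ³/(n+1)) τ(p) + 2Ŵ₁(0)`, `τ(p) = (p² - s⁻²ℓ⁻²)₊` (2.31)–(2.32), and estimates the
result by splitting the momentum space at `|p|² ≍ s⁻²ℓ⁻²` (2.36)–(2.41): the main term is
`∫ Ŵ₁²/(2·(ℓ³/(n+1))p²)` (which (2.42) turns into `∫gω`), everything else is an error of order
`Ŵ₁(0)·(sℓ)⁻³ + Ŵ₁(0)²(sℓ)⁻¹(n+1)/ℓ³ + Ŵ₁(0)³(n+1)²sℓ/ℓ⁶`. This file proves that calculus in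
abstract form, in Mathlib's Fourier normalisation (`k = 2πp`, `k² = 4π²|p|²`): for parameters
`κ, σ, W₀ > 0` (standing for `ℓ³/(n+1)`, `(sℓ)⁻¹`, `Ŵ₁(0)`) and a measurable real function `Wh`
with `|Wh| ≤ W₀` (standing for `Ŵ₁`, `|Ŵ₁(p)| ≤ ∫W₁ = Ŵ₁(0)`), with
`𝒜(p) = κ(4π²|p|² - σ²)₊ + 2W₀`,

`∫ (𝒜 - √(𝒜² - Wh²)) dp ≤ κ⁻¹ ∫ Wh(p)²/(8π²|p|²) dp + (W₀/2)|B(0,r₀)| + K · 4π/r₀`,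
`K = (W₀²(κσ² + 2W₀) + W₀³)/(16π⁴κ²)`, for every splitting radius `r₀` with `4π²r₀² ≥ 2σ²`

(`lintegral_bogoliubov_integrand_le`; in `ℝ≥0∞`, so that no integrability is presupposed).
Ingredients: the scalar bound `𝒜 - √(𝒜²-W²) ≤ W²/(2𝒜) + W⁴/(2𝒜³)` (`sub_sqrt_sq_sub_sq_le`), the
pointwise bounds `|1/(2𝒜) - 1/(8π²κ|p|²)| ≤ (κσ²+2W₀)/(16π⁴κ²|p|⁴)` and `𝒜³ ≥ 2W₀(2π²κ|p|²)²`
on `|p| ≥ r₀` (where `𝒜 ≥ 2π²κ|p|²`), `𝒜 ≥ 2W₀` everywhere, and the radial integrals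
`∫_{|p|≥r₀}|p|⁻⁴dp = 4π/r₀`, `|B(0,r₀)| = (4π/3)r₀³` (polar coordinates,
`lintegral_comp_norm_eq_sphere`).

## References

* [Fournais2020] S. Fournais, *Length scales for BEC in the dilute Bose gas*, arXiv:2011.00309,
  EMS Ser. Congr. Rep. 18 (2021), doi:10.4171/ecr/18-1/7: Lemma 2.4, (2.31)–(2.32), (2.35)–(2.41).
-/

noncomputable section

open MeasureTheory Set Metric
open scoped ENNReal NNReal

namespace Literature.MathematicalPhysics.QuantumManyBody.BoseGas

/-! ### Radial integrals on `ℝ³` -/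

/-- `∫_{|p| ≥ r₀} |p|⁻⁴ dp = 4π/r₀` on `ℝ³` (`r₀ > 0`). [folklore] -/
theorem lintegral_inv_norm_pow_four {r₀ : ℝ} (hr₀ : 0 < r₀) :
    ∫⁻ p in {p : Space | r₀ ≤ ‖p‖}, ENNReal.ofReal ((‖p‖ ^ 4)⁻¹) = ENNReal.ofReal (4 * Real.pi / r₀) := by
  have hS : MeasurableSet {p : Space | r₀ ≤ ‖p‖} := measurableSet_le measurable_const measurable_norm
  set F : ℝ → ℝ≥0∞ := fun r => (Ici r₀).indicator (fun r => ENNReal.ofReal ((r ^ 4)⁻¹)) r with hF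
  have hFm : Measurable F := (ENNReal.measurable_ofReal.comp (by fun_prop)).indicator measurableSet_Ici
  have h1 : ∫⁻ p in {p : Space | r₀ ≤ ‖p‖}, ENNReal.ofReal ((‖p‖ ^ 4)⁻¹) = ∫⁻ p : Space, F ‖p‖ := by
    rw [← lintegral_indicator hS]
    refine lintegral_congr fun p => ?_
    simp only [hF, indicator, mem_setOf_eq, mem_Ici]
  rw [h1, lintegral_comp_norm_eq_sphere hFm]
  -- the radial integral `∫_{r₀}^∞ r² r⁻⁴ dr = 1/r₀`
  have h2 : ∫⁻ r in Ioi (0 : ℝ), ENNReal.ofReal (r ^ 2) * F r = ∫⁻ r in Ioi r₀, ENNReal.ofReal (r ^ (-2 : ℝ)) := by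
    have h3 : ∫⁻ r in Ioi (0 : ℝ), ENNReal.ofReal (r ^ 2) * F r =
        ∫⁻ r in Ioi (0 : ℝ), (Ici r₀).indicator (fun r => ENNReal.ofReal (r ^ (-2 : ℝ))) r := by
      refine setLIntegral_congr_fun measurableSet_Ioi fun r hr => ?_
      simp only [hF, indicator, mem_Ici]
      split_ifs with h
      · rw [← ENNReal.ofReal_mul (sq_nonneg _)]
        congr 1
        have hr0 : 0 < r := hr
        rw [Real.rpow_neg hr0.le, show (2 : ℝ) = ((2 : ℕ) : ℝ) by norm_num, Real.rpow_natCast]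
        field_simp
      · rw [mul_zero]
    rw [h3, lintegral_indicator measurableSet_Ici, Measure.restrict_restrict measurableSet_Ici]
    congr 1
    rw [show Ici r₀ ∩ Ioi (0 : ℝ) = Ici r₀ from inter_eq_left.mpr fun r hr => hr₀.trans_le hr]
    exact (Measure.restrict_congr_set (Ioi_ae_eq_Ici (μ := (volume : Measure ℝ)) (a := r₀))).symm
  have hnn : 0 ≤ᵐ[volume.restrict (Ioi r₀)] fun r : ℝ => r ^ (-2 : ℝ) := by
    filter_upwards [ae_restrict_mem measurableSet_Ioi] with r hr
    exact Real.rpow_nonneg (hr₀.le.trans (le_of_lt hr)) _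
  rw [h2, ← ofReal_integral_eq_lintegral_ofReal (integrableOn_Ioi_rpow_of_lt (by norm_num) hr₀) hnn,
    integral_Ioi_rpow_of_lt (by norm_num) hr₀, ← ENNReal.ofReal_mul (by positivity)]
  congr 1
  rw [show (-2 : ℝ) + 1 = -1 by norm_num, Real.rpow_neg_one]
  field_simp

/-- The complement of the ball `B(0, r₀)` is `{|p| ≥ r₀}`. [folklore] -/
theorem compl_ball_zero_eq (r₀ : ℝ) : (ball (0 : Space) r₀)ᶜ = {p : Space | r₀ ≤ ‖p‖} := by
  ext p
  simp [mem_ball, dist_zero_right, not_lt]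

/-- `|B(0, r₀)| = (4π/3) r₀³` on `ℝ³`. [folklore] -/
theorem volume_ball_zero_eq {r₀ : ℝ} (hr : 0 ≤ r₀) :
    volume (ball (0 : Space) r₀) = ENNReal.ofReal (4 / 3 * Real.pi * r₀ ^ 3) := by
  rw [EuclideanSpace.volume_ball_fin_three, ← ENNReal.ofReal_pow hr, ← ENNReal.ofReal_mul (by positivity)]
  congr 1
  ring

/-! ### Pointwise bounds for `𝒜 - √(𝒜² - Wh²)` -/

section Pointwise

variable {κ σ W₀ : ℝ}

/-- **Low momenta**: with `𝒜 ≥ 2W₀ > 0` and `|W| ≤ W₀`, `𝒜 - √(𝒜² - W²) ≤ W₀/2`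
(`≤ W²/(2𝒜) + W⁴/(2𝒜³) ≤ W₀/4 + W₀/16`). [cite: Fournais2020, (2.35)–(2.37)] -/
theorem sub_sqrt_le_of_two_mul_le {A W : ℝ} (hW₀ : 0 < W₀) (hA : 2 * W₀ ≤ A) (hW : |W| ≤ W₀) :
    A - Real.sqrt (A ^ 2 - W ^ 2) ≤ W₀ / 2 := by
  have hA0 : 0 < A := by linarith
  have hWA : |W| ≤ A := by linarith
  have h := sub_sqrt_sq_sub_sq_le hA0 hWA
  have hW2 : W ^ 2 ≤ W₀ ^ 2 := by nlinarith [abs_nonneg W, sq_abs W, abs_le.mp hW]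
  have hW4 : W ^ 4 ≤ W₀ ^ 4 := by nlinarith [sq_nonneg W]
  have h1 : W ^ 2 / (2 * A) ≤ W₀ ^ 2 / (4 * W₀) := by
    rw [div_le_div_iff₀ (by positivity) (by positivity)]; nlinarith
  have h2 : W ^ 4 / (2 * A ^ 3) ≤ W₀ ^ 4 / (16 * W₀ ^ 3) := by
    rw [div_le_div_iff₀ (by positivity) (by positivity)]
    have hA3 : 8 * W₀ ^ 3 ≤ A ^ 3 := by nlinarith [sq_nonneg (A - 2 * W₀), sq_nonneg A]
    nlinarith [mul_le_mul_of_nonneg_right hW4 (by positivity : (0 : ℝ) ≤ 16 * W₀ ^ 3),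
      mul_le_mul_of_nonneg_left hA3 (by positivity : (0 : ℝ) ≤ 2 * W₀ ^ 4)]
  have h3 : W₀ ^ 2 / (4 * W₀) = W₀ / 4 := by field_simp
  have h4 : W₀ ^ 4 / (16 * W₀ ^ 3) = W₀ / 16 := by field_simp
  linarith [h, h1, h2, h3, h4]

/-- **High momenta**: for `|p| ≥ r₀` with `4π²r₀² ≥ 2σ²` one has `𝒜 = κ(4π²|p|² - σ²) + 2W₀ ≥ 2π²κ|p|²`,
and `𝒜 - √(𝒜² - W²) ≤ W²/(8π²κ|p|²) + K/|p|⁴`, `K = (W₀²(κσ² + 2W₀) + W₀³)/(16π⁴κ²)`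
(`|1/(2𝒜) - 1/(8π²κ|p|²)| ≤ (κσ² + 2W₀)/(16π⁴κ²|p|⁴)`, `𝒜³ ≥ 2W₀(2π²κ|p|²)²`).
[cite: Fournais2020, (2.35)–(2.36), (2.39)–(2.40)] -/
theorem sub_sqrt_le_of_le_norm (hκ : 0 < κ) (hW₀ : 0 < W₀) {r₀ : ℝ} (hr₀ : 0 < r₀)
    (hsplit : 2 * σ ^ 2 ≤ 4 * Real.pi ^ 2 * r₀ ^ 2) {W t : ℝ} (hW : |W| ≤ W₀) (ht : r₀ ≤ t) :
    (κ * max (4 * Real.pi ^ 2 * t ^ 2 - σ ^ 2) 0 + 2 * W₀) -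
        Real.sqrt ((κ * max (4 * Real.pi ^ 2 * t ^ 2 - σ ^ 2) 0 + 2 * W₀) ^ 2 - W ^ 2) ≤
      W ^ 2 / (8 * Real.pi ^ 2 * κ * t ^ 2) +
        (W₀ ^ 2 * (κ * σ ^ 2 + 2 * W₀) + W₀ ^ 3) / (16 * Real.pi ^ 4 * κ ^ 2) * (t ^ 4)⁻¹ := by
  have ht0 : 0 < t := hr₀.trans_le ht
  have hπ := Real.pi_pos
  have ht2 : r₀ ^ 2 ≤ t ^ 2 := pow_le_pow_left₀ hr₀.le ht 2
  have hσt : σ ^ 2 ≤ 2 * Real.pi ^ 2 * t ^ 2 := by nlinarith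
  have hmax : max (4 * Real.pi ^ 2 * t ^ 2 - σ ^ 2) 0 = 4 * Real.pi ^ 2 * t ^ 2 - σ ^ 2 :=
    max_eq_left (by nlinarith)
  rw [hmax]
  set A := κ * (4 * Real.pi ^ 2 * t ^ 2 - σ ^ 2) + 2 * W₀ with hA_def
  set B := 4 * Real.pi ^ 2 * κ * t ^ 2 with hB_def
  have hB0 : 0 < B := by positivity
  have hAB : A = B - κ * σ ^ 2 + 2 * W₀ := by rw [hA_def, hB_def]; ring
  have hA2 : 2 * W₀ ≤ A := by rw [hA_def]; nlinarith
  have hAlow : 2 * Real.pi ^ 2 * κ * t ^ 2 ≤ A := by rw [hA_def]; nlinarith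
  have hA0 : 0 < A := by linarith
  have hWA : |W| ≤ A := by linarith
  have h := sub_sqrt_sq_sub_sq_le hA0 hWA
  have hW2 : W ^ 2 ≤ W₀ ^ 2 := by nlinarith [abs_nonneg W, sq_abs W, abs_le.mp hW]
  -- (i) `W²/(2A) = W²/(2B) + W²(κσ² - 2W₀)/(2AB)`
  have hi : W ^ 2 / (2 * A) = W ^ 2 / (2 * B) + W ^ 2 * (κ * σ ^ 2 - 2 * W₀) / (2 * A * B) := by
    rw [hAB]
    have : B - κ * σ ^ 2 + 2 * W₀ ≠ 0 := by rw [← hAB]; exact hA0.ne'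
    field_simp
    ring
  have hAB16 : 16 * Real.pi ^ 4 * κ ^ 2 * t ^ 4 ≤ 2 * A * B := by
    have : 2 * A * B ≥ 2 * (2 * Real.pi ^ 2 * κ * t ^ 2) * B := by nlinarith
    rw [hB_def] at this ⊢
    nlinarith
  have hi' : W ^ 2 * (κ * σ ^ 2 - 2 * W₀) / (2 * A * B) ≤
      W₀ ^ 2 * (κ * σ ^ 2 + 2 * W₀) / (16 * Real.pi ^ 4 * κ ^ 2 * t ^ 4) := by
    have hnum : W ^ 2 * (κ * σ ^ 2 - 2 * W₀) ≤ W₀ ^ 2 * (κ * σ ^ 2 + 2 * W₀) := by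
      have h1 : W ^ 2 * (κ * σ ^ 2 - 2 * W₀) ≤ W ^ 2 * (κ * σ ^ 2 + 2 * W₀) := by
        nlinarith [sq_nonneg W]
      nlinarith [h1, mul_nonneg (sub_nonneg.mpr hW2) (by positivity : (0 : ℝ) ≤ κ * σ ^ 2 + 2 * W₀)]
    calc W ^ 2 * (κ * σ ^ 2 - 2 * W₀) / (2 * A * B)
        ≤ W₀ ^ 2 * (κ * σ ^ 2 + 2 * W₀) / (2 * A * B) := div_le_div_of_nonneg_right hnum (by positivity)
      _ ≤ W₀ ^ 2 * (κ * σ ^ 2 + 2 * W₀) / (16 * Real.pi ^ 4 * κ ^ 2 * t ^ 4) :=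
          div_le_div_of_nonneg_left (by positivity) (by positivity) hAB16
  -- (ii) `W⁴/(2A³) ≤ W₀³/(16π⁴κ²t⁴)`
  have hii : W ^ 4 / (2 * A ^ 3) ≤ W₀ ^ 3 / (16 * Real.pi ^ 4 * κ ^ 2 * t ^ 4) := by
    have hW4 : W ^ 4 ≤ W₀ ^ 4 := by nlinarith [sq_nonneg W]
    have hA3 : 2 * W₀ * (2 * Real.pi ^ 2 * κ * t ^ 2) ^ 2 ≤ A ^ 3 := by
      have hsq : (2 * Real.pi ^ 2 * κ * t ^ 2) ^ 2 ≤ A ^ 2 := pow_le_pow_left₀ (by positivity) hAlow 2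
      calc 2 * W₀ * (2 * Real.pi ^ 2 * κ * t ^ 2) ^ 2 ≤ A * A ^ 2 :=
            mul_le_mul hA2 hsq (by positivity) hA0.le
        _ = A ^ 3 := by ring
    rw [div_le_div_iff₀ (by positivity) (by positivity)]
    calc W ^ 4 * (16 * Real.pi ^ 4 * κ ^ 2 * t ^ 4) ≤ W₀ ^ 4 * (16 * Real.pi ^ 4 * κ ^ 2 * t ^ 4) := by
          gcongr
      _ = W₀ ^ 3 * (2 * (2 * W₀ * (2 * Real.pi ^ 2 * κ * t ^ 2) ^ 2)) := by ring
      _ ≤ W₀ ^ 3 * (2 * A ^ 3) := by gcongr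
  -- assemble
  have hB8 : W ^ 2 / (2 * B) = W ^ 2 / (8 * Real.pi ^ 2 * κ * t ^ 2) := by rw [hB_def]; ring_nf
  have hK : W₀ ^ 2 * (κ * σ ^ 2 + 2 * W₀) / (16 * Real.pi ^ 4 * κ ^ 2 * t ^ 4) +
      W₀ ^ 3 / (16 * Real.pi ^ 4 * κ ^ 2 * t ^ 4) =
      (W₀ ^ 2 * (κ * σ ^ 2 + 2 * W₀) + W₀ ^ 3) / (16 * Real.pi ^ 4 * κ ^ 2) * (t ^ 4)⁻¹ := by
    field_simp
  linarith [h, hi, hi', hii, hB8, hK]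

end Pointwise

/-! ### The momentum integral -/

/-- **Fournais 2020, (2.36)–(2.41): the momentum integral of the Bogoliubov bound.** For
`κ, σ, W₀, r₀ > 0` with `4π²r₀² ≥ 2σ²` and a measurable `Wh` with `|Wh| ≤ W₀`, writing
`𝒜(p) = κ(4π²|p|² - σ²)₊ + 2W₀`,
`∫ (𝒜 - √(𝒜² - Wh²)) dp ≤ κ⁻¹∫ Wh²/(8π²|p|²) dp + (W₀/2)(4π/3)r₀³ + K·4π/r₀`,
`K = (W₀²(κσ² + 2W₀) + W₀³)/(16π⁴κ²)` (in the paper: `κ = ℓ³/(n+1)`, `σ = (sℓ)⁻¹`, `W₀ = Ŵ₁(0)`,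
`Wh = Ŵ₁`, the first term is `I` (2.38), the others are (2.37) and `II` (2.39)–(2.41)).
[cite: Fournais2020, (2.36)–(2.41)] -/
theorem lintegral_bogoliubov_integrand_le {κ σ W₀ r₀ : ℝ} (hκ : 0 < κ) (hW₀ : 0 < W₀)
    (hr₀ : 0 < r₀) (hsplit : 2 * σ ^ 2 ≤ 4 * Real.pi ^ 2 * r₀ ^ 2) {Wh : Space → ℝ} (hWm : Measurable Wh)
    (hWb : ∀ p, |Wh p| ≤ W₀) :
    ∫⁻ p : Space, ENNReal.ofReal
        ((κ * max (4 * Real.pi ^ 2 * ‖p‖ ^ 2 - σ ^ 2) 0 + 2 * W₀) -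
          Real.sqrt ((κ * max (4 * Real.pi ^ 2 * ‖p‖ ^ 2 - σ ^ 2) 0 + 2 * W₀) ^ 2 - Wh p ^ 2)) ≤
      ENNReal.ofReal κ⁻¹ * (∫⁻ p : Space, ENNReal.ofReal (Wh p ^ 2 / (8 * Real.pi ^ 2 * ‖p‖ ^ 2))) +
        ENNReal.ofReal (W₀ / 2 * (4 / 3 * Real.pi * r₀ ^ 3) +
          (W₀ ^ 2 * (κ * σ ^ 2 + 2 * W₀) + W₀ ^ 3) / (16 * Real.pi ^ 4 * κ ^ 2) * (4 * Real.pi / r₀)) := by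
  have hπ := Real.pi_pos
  set K : ℝ := (W₀ ^ 2 * (κ * σ ^ 2 + 2 * W₀) + W₀ ^ 3) / (16 * Real.pi ^ 4 * κ ^ 2) with hK
  have hK0 : 0 ≤ K := by positivity
  set f : Space → ℝ := fun p => (κ * max (4 * Real.pi ^ 2 * ‖p‖ ^ 2 - σ ^ 2) 0 + 2 * W₀) -
    Real.sqrt ((κ * max (4 * Real.pi ^ 2 * ‖p‖ ^ 2 - σ ^ 2) 0 + 2 * W₀) ^ 2 - Wh p ^ 2) with hf
  have hA2 : ∀ p : Space, 2 * W₀ ≤ κ * max (4 * Real.pi ^ 2 * ‖p‖ ^ 2 - σ ^ 2) 0 + 2 * W₀ := fun p => by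
    have : 0 ≤ κ * max (4 * Real.pi ^ 2 * ‖p‖ ^ 2 - σ ^ 2) 0 := mul_nonneg hκ.le (le_max_right _ _)
    linarith
  -- split at `|p| = r₀`
  rw [← lintegral_add_compl (fun p => ENNReal.ofReal (f p)) (measurableSet_ball (x := (0 : Space)) (ε := r₀))]
  -- low momenta
  have hlow : ∫⁻ p in ball (0 : Space) r₀, ENNReal.ofReal (f p) ≤ ENNReal.ofReal (W₀ / 2 * (4 / 3 * Real.pi * r₀ ^ 3)) := by
    calc ∫⁻ p in ball (0 : Space) r₀, ENNReal.ofReal (f p) ≤ ∫⁻ _ in ball (0 : Space) r₀, ENNReal.ofReal (W₀ / 2) :=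
          lintegral_mono fun p => ENNReal.ofReal_le_ofReal (sub_sqrt_le_of_two_mul_le hW₀ (hA2 p) (hWb p))
      _ = ENNReal.ofReal (W₀ / 2 * (4 / 3 * Real.pi * r₀ ^ 3)) := by
          rw [setLIntegral_const, volume_ball_zero_eq hr₀.le, ← ENNReal.ofReal_mul (by positivity)]
  -- high momenta
  have hhigh : ∫⁻ p in (ball (0 : Space) r₀)ᶜ, ENNReal.ofReal (f p) ≤
      ENNReal.ofReal κ⁻¹ * (∫⁻ p : Space, ENNReal.ofReal (Wh p ^ 2 / (8 * Real.pi ^ 2 * ‖p‖ ^ 2))) +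
        ENNReal.ofReal (K * (4 * Real.pi / r₀)) := by
    rw [compl_ball_zero_eq]
    have hmeas : Measurable fun p : Space => ENNReal.ofReal (κ⁻¹ * (Wh p ^ 2 / (8 * Real.pi ^ 2 * ‖p‖ ^ 2))) :=
      ENNReal.measurable_ofReal.comp ((hWm.pow_const 2).div (by fun_prop) |>.const_mul _)
    calc ∫⁻ p in {p : Space | r₀ ≤ ‖p‖}, ENNReal.ofReal (f p)
        ≤ ∫⁻ p in {p : Space | r₀ ≤ ‖p‖}, (ENNReal.ofReal (κ⁻¹ * (Wh p ^ 2 / (8 * Real.pi ^ 2 * ‖p‖ ^ 2))) +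
            ENNReal.ofReal K * ENNReal.ofReal ((‖p‖ ^ 4)⁻¹)) := by
          refine setLIntegral_mono' (measurableSet_le measurable_const measurable_norm) fun p hp => ?_
          have hb := sub_sqrt_le_of_le_norm (σ := σ) hκ hW₀ hr₀ hsplit (hWb p) hp
          rw [← ENNReal.ofReal_mul hK0, ← ENNReal.ofReal_add (by positivity) (by positivity)]
          refine ENNReal.ofReal_le_ofReal (hb.trans_eq ?_)
          rw [hK]
          field_simp
      _ = (∫⁻ p in {p : Space | r₀ ≤ ‖p‖}, ENNReal.ofReal (κ⁻¹ * (Wh p ^ 2 / (8 * Real.pi ^ 2 * ‖p‖ ^ 2)))) +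
            ENNReal.ofReal K * ∫⁻ p in {p : Space | r₀ ≤ ‖p‖}, ENNReal.ofReal ((‖p‖ ^ 4)⁻¹) := by
          rw [lintegral_add_left hmeas, lintegral_const_mul' _ _ ENNReal.ofReal_ne_top]
      _ ≤ (∫⁻ p : Space, ENNReal.ofReal (κ⁻¹ * (Wh p ^ 2 / (8 * Real.pi ^ 2 * ‖p‖ ^ 2)))) +
            ENNReal.ofReal K * ENNReal.ofReal (4 * Real.pi / r₀) := by
          gcongr
          · exact Measure.restrict_le_self
          · exact (lintegral_inv_norm_pow_four hr₀).le
      _ = _ := by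
          rw [← ENNReal.ofReal_mul hK0, ← lintegral_const_mul' _ _ ENNReal.ofReal_ne_top]
          congr 1
          refine lintegral_congr fun p => ?_
          rw [← ENNReal.ofReal_mul (inv_nonneg.mpr hκ.le)]
  calc (∫⁻ p in ball (0 : Space) r₀, ENNReal.ofReal (f p)) + ∫⁻ p in (ball (0 : Space) r₀)ᶜ, ENNReal.ofReal (f p)
      ≤ ENNReal.ofReal (W₀ / 2 * (4 / 3 * Real.pi * r₀ ^ 3)) +
          (ENNReal.ofReal κ⁻¹ * (∫⁻ p : Space, ENNReal.ofReal (Wh p ^ 2 / (8 * Real.pi ^ 2 * ‖p‖ ^ 2))) +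
            ENNReal.ofReal (K * (4 * Real.pi / r₀))) := add_le_add hlow hhigh
    _ = _ := by
        rw [ENNReal.ofReal_add (by positivity) (by positivity)]
        rw [add_left_comm]

end Literature.MathematicalPhysics.QuantumManyBody.BoseGas

end
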